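import Mathlib.MeasureTheory.Function.LpSeminorm.Indicator
import Mathlib.Topology.LocallyConstant.Basic
import Literature.NumberTheory.Automorphic.MatrixCoefficients
import HarnessLib

/-!
# Matrix coefficients of smooth representations — proofs

Discharges, sorry-free, of named facts of
`Literature.NumberTheory.Automorphic.MatrixCoefficients` (whose statements are left untouched):

* `Representation.IsSupercuspidal.isSquareIntegrableModCenter_holds :
    Representation.IsSupercuspidal.isSquareIntegrableModCenter` — a smooth supercuspidal
  representation with unitary central character is square-integrable modulo the centre. This is
  Harish-Chandra's remark "Obviously `°𝓔(G) ⊂ 𝓔₂(G)`" (LNM 162, Part I §3, p. 9: every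
  supercuspidal class is in the discrete series `𝓔₂(G)` of Part I §1, p. 4), in the
  smooth-category, domination form in which the fact is vendored.

and its repackaging `Representation.IsSupercuspidal.isDiscreteSeries` (supercuspidal, smooth,
unitarizable, unitary central character ⇒ `IsDiscreteSeries μ` for every Haar measure `μ`),
together with the three elementary lemmas the proof uses and which are of independent use:

* `Representation.matrixCoeff_mul_of_hasCentralCharacter`: under a central character `ω`,
  `c_{φ,v}(g z) = ω(z) c_{φ,v}(g)` for `z ∈ Z(G)`;
* `Representation.isLocallyConstant_matrixCoeff`, `Representation.continuous_matrixCoeff`: a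
  matrix coefficient attached to a smooth vector is locally constant, hence continuous
  (Bushnell–Henniart §10.1);

and two consequences of unitarizability which make the standing presupposition "unitary central
character" of the analytic predicates of `MatrixCoefficients.lean` automatic for unitarizable
(in particular for discrete series, `IsDiscreteSeries = IsUnitarizable ∧ …`) representations:

* `Representation.IsUnitarizable.norm_eq_one_of_apply_eq_smul`: if `ρ` is unitarizable and
  `ρ g v = c • v` with `v ≠ 0`, then `‖c‖ = 1`;
* `Representation.IsUnitarizable.norm_centralCharacter_eq_one`: a unitarizable representation on
  a non-zero space has *unitary* central character (whenever it has one), whence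
  `Representation.IsSupercuspidal.isDiscreteSeries_of_hasCentralCharacter`, the repackaging
  above with the hypothesis `‖ω z‖ = 1` removed.

## Proof sketch (as in Bushnell–Henniart §10.1–10.2 / Casselman Proposition 5.2.4)

Fix `φ ∈ Ṽ`, `v ∈ V`, `c = c_{φ,v}`; supercuspidality gives `supp c ⊆ C · Z(G)` with `C`
compact. Smoothness of `v` makes `c` constant on each open left translate `g · Stab(v)`, so `c`
is continuous and bounded by some `M` on `C`. The image `π(C) ⊆ G ⧸ Z(G)` is compact, hence of
finite Haar measure; with `S ⊇ π(C)` a measurable hull of the same measure,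
`f = max M 0 · 𝟙_S ∈ L²(G ⧸ Z(G), μ)`. If `c g ≠ 0` then `g = x z`, `x ∈ C`, `z ∈ Z(G)`, so
`π g = π x ∈ S` and, `ω` being unitary, `‖c g‖ = ‖ω z‖ ‖c x‖ = ‖c x‖ ≤ M = f (π g)`; if `c g = 0`
the bound holds as `f ≥ 0`. No Hausdorff or second-countability hypothesis is needed.

## References

* Harish-Chandra, *Harmonic analysis on reductive `p`-adic groups* (notes by G. van Dijk),
  Lecture Notes in Mathematics 162, Springer (1970), Part I §1 p. 4 and §3 p. 9.
* C. J. Bushnell, G. Henniart, *The local Langlands conjecture for `GL(2)`*, Grundlehren 335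
  (2006), §10.1–10.2, §17.4.
* W. Casselman, *Introduction to the theory of admissible representations of `p`-adic reductive
  groups* (unpublished notes, 1974/1995), Proposition 5.2.4.
-/

open MeasureTheory
open scoped ENNReal Pointwise

namespace Representation

/-! ### Elementary lemmas on matrix coefficients -/

section CommRing

variable {k G V : Type*} [CommRing k] [Group G] [AddCommGroup V] [Module k V]
  (ρ : Representation k G V)

/-- Under a central character `ω`, right translation by a central element `z` multiplies every
matrix coefficient by the scalar `ω z`: `c_{φ,v}(g z) = ω(z) c_{φ,v}(g)`
(`matrixCoeff_mul` and `HasCentralCharacter.apply`). [folklore] -/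
lemma matrixCoeff_mul_of_hasCentralCharacter {ω : Subgroup.center G →* kˣ}
    (hω : ρ.HasCentralCharacter ω) (φ : Module.Dual k V) (v : V) (g : G)
    (z : Subgroup.center G) :
    ρ.matrixCoeff φ v (g * z) = ((ω z : kˣ) : k) * ρ.matrixCoeff φ v g := by
  rw [matrixCoeff_mul, hω.apply z v, matrixCoeff_apply, matrixCoeff_apply, map_smul, map_smul,
    smul_eq_mul]

variable [TopologicalSpace G] [SeparatelyContinuousMul G]

/-- A matrix coefficient `c_{φ,v}` attached to a *smooth* vector `v` is locally constant: it is
constant on each left translate `g · Stab(v)` of the open stabiliser of `v` (an open set, left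
translations being open maps), since `c_{φ,v}(g h) = c_{φ, ρ(h) v}(g) = c_{φ,v}(g)` for
`h ∈ Stab(v)` (`matrixCoeff_mul`). (Bushnell–Henniart §10.1: smooth matrix coefficients are
locally constant.) [folklore] -/
lemma isLocallyConstant_matrixCoeff (φ : Module.Dual k V) {v : V} (hv : ρ.IsSmoothVector v) :
    IsLocallyConstant (ρ.matrixCoeff φ v) := by
  refine (IsLocallyConstant.iff_exists_open _).2 fun g => ?_
  refine ⟨(g * ·) '' (ρ.stabilizerSubgroup v : Set G), isOpenMap_mul_left g _ hv,
    ⟨1, (ρ.stabilizerSubgroup v).one_mem, mul_one g⟩, ?_⟩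
  rintro _ ⟨h, hh, rfl⟩
  rw [matrixCoeff_mul, (ρ.mem_stabilizerSubgroup v h).1 hh]

/-- A matrix coefficient attached to a smooth vector is continuous, for any topology on `k`
(it is locally constant, `isLocallyConstant_matrixCoeff`). [folklore] -/
lemma continuous_matrixCoeff [TopologicalSpace k] (φ : Module.Dual k V) {v : V}
    (hv : ρ.IsSmoothVector v) : Continuous (ρ.matrixCoeff φ v) :=
  (ρ.isLocallyConstant_matrixCoeff φ hv).continuous

end CommRing

/-! ### Unitarizability forces unimodular eigenvalues and a unitary central character -/

section Unitarizable

variable {G V : Type*} [Group G] [AddCommGroup V] [Module ℂ V] {ρ : Representation ℂ G V}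

/-- If `ρ` is unitarizable and some `g ∈ G` acts on a non-zero vector `v` by the scalar `c`
(`ρ g v = c • v`), then `‖c‖ = 1`: for a `G`-invariant positive-definite Hermitian form `B`,
`B v v = B (ρ g v) (ρ g v) = (conj c * c) * B v v = ‖c‖² B v v` and `B v v ≠ 0`. In particular
a unitarizable representation has unitary central character
(`IsUnitarizable.norm_centralCharacter_eq_one`) and, e.g., the character `n ↦ 2ⁿ` of `ℤ` is not
unitarizable. [folklore] -/
theorem IsUnitarizable.norm_eq_one_of_apply_eq_smul (h : ρ.IsUnitarizable) {g : G} {v : V}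
    (hv : v ≠ 0) {c : ℂ} (hc : ρ g v = c • v) : ‖c‖ = 1 := by
  obtain ⟨B, -, hpos, hinv⟩ := h
  have hBv : B v v ≠ 0 := fun h0 => (hpos v hv).ne' (by rw [h0, Complex.zero_re])
  have key := hinv g v v
  rw [hc, LinearMap.map_smulₛₗ₂, LinearMap.map_smul, smul_smul, smul_eq_mul] at key
  have h1 : (starRingEnd ℂ) c * c = 1 := mul_right_cancel₀ hBv (key.trans (one_mul _).symm)
  have h2 : ((‖c‖ : ℝ) : ℂ) ^ 2 = 1 := by rw [← Complex.conj_mul', h1]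
  have h3 : ‖c‖ ^ 2 = 1 := by exact_mod_cast h2
  exact (pow_eq_one_iff_of_nonneg (norm_nonneg c) two_ne_zero).1 h3

/-- A unitarizable representation on a non-zero space which admits a central character `ω` has
*unitary* central character: `‖ω z‖ = 1` for every `z ∈ Z(G)` (apply
`IsUnitarizable.norm_eq_one_of_apply_eq_smul` to any non-zero vector, on which `z` acts by the
scalar `ω z`). This is the standing presupposition under which `IsSquareIntegrableModCenter`,
`IsTempered` and `IsDiscreteSeries` render the textbook notions (see their docstrings in
`MatrixCoefficients.lean`); for unitarizable — in particular discrete series — representations it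
is therefore automatic. (Bushnell–Henniart §11.1; Wallach RRG I §1.4.) [folklore] -/
theorem IsUnitarizable.norm_centralCharacter_eq_one [Nontrivial V] (h : ρ.IsUnitarizable)
    {ω : Subgroup.center G →* ℂˣ} (hω : ρ.HasCentralCharacter ω) (z : Subgroup.center G) :
    ‖((ω z : ℂˣ) : ℂ)‖ = 1 := by
  obtain ⟨v, hv⟩ := exists_ne (0 : V)
  exact h.norm_eq_one_of_apply_eq_smul hv (hω.apply z v)

end Unitarizable

/-! ### Supercuspidal representations are square-integrable modulo the centre -/

section Discharge

variable {G V : Type*} [Group G] [TopologicalSpace G] [IsTopologicalGroup G]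
  [AddCommGroup V] [Module ℂ V] [MeasurableSpace (G ⧸ Subgroup.center G)]

/-- **Discharge of `IsSupercuspidal.isSquareIntegrableModCenter`** — a smooth supercuspidal
representation with unitary central character is square-integrable modulo the centre, with
respect to any Haar measure `μ` on `G ⧸ Z(G)` (Harish-Chandra, LNM 162, Part I §3, p. 9:
"Obviously `°𝓔(G) ⊂ 𝓔₂(G)`"; Bushnell–Henniart §10.1–10.2 and §17.4; Casselman,
Proposition 5.2.4).

*Proof.* Fix `φ ∈ Ṽ`, `v ∈ V` and let `c = c_{φ,v}`; by supercuspidality `supp c ⊆ C · Z(G)`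
with `C` compact. As `ρ` is smooth, `c` is continuous (`continuous_matrixCoeff`), hence bounded
on `C`, say by `M`. The image `π(C)` of `C` in `G ⧸ Z(G)` is compact, so of finite measure; let
`S ⊇ π(C)` be a measurable hull of the same measure (`toMeasurable`) and `f = max M 0 · 𝟙_S`,
an `L²` function (`memLp_indicator_const`). If `c g ≠ 0` then `g = x z` with `x ∈ C`,
`z ∈ Z(G)`, so `π g = π x ∈ S` and, the central character being unitary,
`‖c g‖ = ‖ω z‖ ‖c x‖ = ‖c x‖ ≤ M = f (π g)` (`matrixCoeff_mul_of_hasCentralCharacter`); if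
`c g = 0` the bound is trivial as `f ≥ 0`. [cite: HarishChandra1970, Part I §3, p. 9] -/
theorem IsSupercuspidal.isSquareIntegrableModCenter_holds :
    IsSupercuspidal.isSquareIntegrableModCenter (G := G) (V := V) := by
  intro μ _ ρ hsmooth h ω hω hω' φ hφ v
  obtain ⟨C, hC, hsupp⟩ := h φ hφ v
  -- `c` is continuous, hence bounded by some `M` on the compact set `C`
  obtain ⟨M, hM⟩ := hC.exists_bound_of_continuousOn
    (ρ.continuous_matrixCoeff φ (hsmooth v)).continuousOn
  -- a measurable hull of finite measure of the (compact) image of `C` in `G ⧸ Z(G)`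
  set π : G → G ⧸ Subgroup.center G := QuotientGroup.mk with hπ
  have hπC : μ (π '' C) ≠ ∞ := (hC.image QuotientGroup.continuous_mk).measure_lt_top.ne
  refine ⟨(toMeasurable μ (π '' C)).indicator fun _ => max M 0,
    memLp_indicator_const 2 (measurableSet_toMeasurable μ _) (max M 0)
      (Or.inr ((measure_toMeasurable _).trans_ne hπC)), fun g => ?_⟩
  by_cases hg : ρ.matrixCoeff φ v g = 0
  · rw [hg, norm_zero]
    exact Set.indicator_nonneg (fun _ _ => le_max_right M 0) _
  · obtain ⟨x, hx, z, hz, rfl⟩ := Set.mem_mul.1 (hsupp (Function.mem_support.2 hg))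
    have hxz : (π (x * z) : G ⧸ Subgroup.center G) = π x := by
      rw [hπ, QuotientGroup.eq, mul_inv_rev, inv_mul_cancel_right]
      exact inv_mem hz
    have hmem : π (x * z) ∈ toMeasurable μ (π '' C) :=
      subset_toMeasurable μ _ (hxz ▸ Set.mem_image_of_mem π hx)
    rw [Set.indicator_of_mem hmem]
    calc ‖ρ.matrixCoeff φ v (x * z)‖ = ‖ρ.matrixCoeff φ v x‖ := by
          rw [ρ.matrixCoeff_mul_of_hasCentralCharacter hω φ v x ⟨z, hz⟩, norm_mul, hω',
            one_mul]
      _ ≤ M := hM x hx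
      _ ≤ max M 0 := le_max_left M 0

/-- **Supercuspidal representations are discrete series** — Harish-Chandra's
"Obviously `°𝓔(G) ⊂ 𝓔₂(G)`" (LNM 162, Part I §3, p. 9) in the vocabulary of
`MatrixCoefficients.lean`: a smooth, unitarizable, supercuspidal representation with unitary
central character is discrete series (`IsDiscreteSeries = IsUnitarizable ∧
IsSquareIntegrableModCenter`) with respect to every Haar measure on `G ⧸ Z(G)`; immediate from
`IsSupercuspidal.isSquareIntegrableModCenter_holds`. [cite: HarishChandra1970, Part I §3, p. 9] -/
theorem IsSupercuspidal.isDiscreteSeries (μ : Measure (G ⧸ Subgroup.center G)) [μ.IsHaarMeasure]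
    {ρ : Representation ℂ G V} (hsmooth : ρ.IsSmooth) (h : ρ.IsSupercuspidal)
    (hunit : ρ.IsUnitarizable) {ω : Subgroup.center G →* ℂˣ} (hω : ρ.HasCentralCharacter ω)
    (hω' : ∀ z : Subgroup.center G, ‖((ω z : ℂˣ) : ℂ)‖ = 1) : ρ.IsDiscreteSeries μ :=
  ⟨hunit, IsSupercuspidal.isSquareIntegrableModCenter_holds μ hsmooth h hω hω'⟩

/-- **Supercuspidal representations are discrete series**, with the unitarity hypothesis on the
central character of `IsSupercuspidal.isDiscreteSeries` removed: a smooth, unitarizable,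
supercuspidal representation admitting a central character `ω` is discrete series with respect
to every Haar measure on `G ⧸ Z(G)`. If `V ≠ 0`, unitarizability forces `‖ω z‖ = 1`
(`IsUnitarizable.norm_centralCharacter_eq_one`) and `IsSupercuspidal.isDiscreteSeries` applies;
if `V = 0`, every matrix coefficient vanishes and is dominated by `0 ∈ L²`. (Harish-Chandra,
LNM 162, Part I §3, p. 9, "Obviously `°𝓔(G) ⊂ 𝓔₂(G)`", where representations are unitary from
the outset.) [cite: HarishChandra1970, Part I §3, p. 9] -/
theorem IsSupercuspidal.isDiscreteSeries_of_hasCentralCharacter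
    (μ : Measure (G ⧸ Subgroup.center G)) [μ.IsHaarMeasure] {ρ : Representation ℂ G V}
    (hsmooth : ρ.IsSmooth) (h : ρ.IsSupercuspidal) (hunit : ρ.IsUnitarizable)
    {ω : Subgroup.center G →* ℂˣ} (hω : ρ.HasCentralCharacter ω) : ρ.IsDiscreteSeries μ := by
  rcases subsingleton_or_nontrivial V with hV | hV
  · refine ⟨hunit, fun φ _ v => ⟨0, MemLp.zero, fun g => ?_⟩⟩
    obtain rfl : v = 0 := Subsingleton.elim v 0
    simp [matrixCoeff_apply]
  · exact IsSupercuspidal.isDiscreteSeries μ hsmooth h hunit hω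
      (hunit.norm_centralCharacter_eq_one hω)

end Discharge

end Representation
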